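import Literature.Combinatorics.Enumerative.ForestAccessibilityMatrix
import HarnessLib

/-!
# The forest matrices `Q_k` and the Leverrier–Faddeev recurrence `Q_{k+1} = σ_{k+1} I − L Q_k`
# (Chebotarev–Agaev 2002, §5 Proposition 4; «tr Q_k = (n − k) σ_k»; `L Q_{n−d} = 0`)

Lane `lit-hodgefound`, seat p23, generation 47, row g47-#15 of the programme «Tree and forest formulas
for finite Markov chains». Vocabulary of `MatrixForestTheoremInverse` / `ForestAccessibilityMatrix`:
`forestWeight a R = w(R)`, `forestWeightTo a R i j = w_{ij}(R)`; the forest matrix of the in-forests with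
`m` ROOTS (`k = n − m` arcs) is written entrywise as `Σ_{R ∋ j, |R| = m} w_{ij}(R)` (`= q^{n−m}_{ij}`) and
`σ_{n−m} = Σ_{|R| = m} w(R)`; no new definition is introduced.

## Source, verbatim ([ChebotarevAgaev2002], held text `paper:arxiv-math_0508178`, §5 p. 9)

«**Proposition 3.** `adj(λI + L) = Σ_{k=0}^{n−d} Q_k λ^{n−k−1}`. […] **Proposition 4.** For any
`k = 0, 1, …`, `Q_{k+1} = (−L)Q_k + σ_{k+1} I`, `σ_{k+1} = tr(LQ_k)/(k+1)`. Since, by Proposition 3,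
`Q_0, ⋯, Q_n` are the matrix coefficients in the polynomial form of `adj(λI + L)`, where `λI + L` is the
characteristic matrix of `−L` and, by Proposition 2, `σ_0, ⋯, σ_n` are the coefficients of the
characteristic polynomial of `−L`, the equations [Gantmacher66] `Q_{k+1} = σ_{k+1} I − LQ_k`, `k = 0, 1, …`,
take place. To prove (Fadd2), it suffices to take the traces on the left and on the right of (Fadd1)
and use the fact that `tr Q_k = (n − k) σ_k`, `k = 0, 1, …`, which holds since every in-forest with `k`
arcs has `n − k` roots.» — and §5 p. 12: «By virtue of Proposition (LJ̄ = 0), every nonzero column of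
`J̄` (or `Q_{n−d}`) is an eigenvector of `L` that corresponds to the zero eigenvalue.»

Here Proposition 4 is proved DIRECTLY on forests (not through Proposition 3): the graded form of the
tree's `(I + L)·Q = σ·I` (`one_add_wLaplacian_mul_accessibility`), with the arc-removal bijection
`forestWeightTo_eq_sum_mul_forestWeightTo_insert` shifting the number of roots by one.

## What is here (arbitrary arc weights `a : V → V → S`, `S` a commutative ring)

* **`ChebotarevAgaev2002_prop_4`** — for `1 ≤ m`: `Q^{[m−1]} + L · Q^{[m]} = σ^{[m−1]} · I`, i.e.
  `Q_{k+1} = σ_{k+1} I − L Q_k` with `k = n − m`;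
* **`trace_forestMatrix`** — «`tr Q_k = (n − k) σ_k`»: `Σ_i Σ_{R ∋ i, |R| = m} w_{ii}(R) = m · σ^{[m]}`;
* **`trace_wLaplacian_mul_forestMatrix`** — the trace form `tr(L Q_k) = (k+1) σ_{k+1}` (denominator
  cleared): `tr(L · Q^{[m]}) = (n + 1 − m) σ^{[m−1]}`;
* **`wLaplacian_mul_forestMatrix_eq_zero`** — `L · Q^{[m]} = 0` as soon as no forest sum with `m − 1`
  roots survives (`Q^{[m−1]} = 0`, `σ^{[m−1]} = 0`; e.g. `m = d` the in-forest dimension for non-negative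
  weights): the columns of the matrix of maximum in-forests are null vectors of `L`.

* §5 (appended, row g47-#17) — **the ROW form `Q_{k+1} = σ_{k+1} I − Q_k L`** (`ChebotarevAgaev2002_prop_4_row`),
  by coefficient extraction: the tree's `Q·(I + L) = σ·I` (`accessibility_mul_one_add_wLaplacian`, from
  `Q = adj(I+L)`) applied over `S[X]` to the weights `X · a` — there `σ(X)` has constant term `w(V) = 1`, so
  it is regular — and `coeff_{X^{n−m+1}}`; whence **`forestMatrix_mul_wLaplacian_eq_zero`**: the ROWS of
  the matrix of maximum in-forests are left null vectors of `L` (for `L = I − P`: invariant measures).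

THEOREMS ONLY (no definition, no named fact, no instance).

## References

* [ChebotarevAgaev2002] §5 Propositions 3–4, Proposition (LJ̄ = 0).
* Tree: `ForestAccessibilityMatrix` (`forestWeightTo_eq_sum_mul_forestWeightTo_insert`,
  `sum_wLaplacian_mul_forestWeightTo_of_not_mem`, `sum_wLaplacian_mul_forestWeightTo_of_mem`,
  `outWeight_mul_forestWeight_sub`).
-/

namespace Literature.Combinatorics.Enumerative

open Finset Function Matrix Literature.Combinatorics.SimpleGraph.WeightedMatrixForest

variable {V : Type*} [Fintype V] [DecidableEq V] {S : Type*} [CommRing S] (a : V → V → S)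

/-! ### §1 Graded re-indexing `R ↦ R ∪ {i}` -/

/-- Graded arc removal: for `i ≠ j` and `1 ≤ m`,
`Σ_{R ∋ j, R ∌ i, |R| = m−1} w_{ij}(R) = Σ_{R ∋ i, j, |R| = m} Σ_{k ≠ i} a_{ik} w_{kj}(R)`.
[cite: ChebotarevAgaev2002, §5 Proposition 4 (proof: «every in-forest with `k` arcs has `n − k` roots»)] -/
theorem sum_forestWeightTo_not_mem_eq_card {i j : V} (hij : i ≠ j) {m : ℕ} (hm : 1 ≤ m) :
    ∑ R ∈ ((univ : Finset V).powersetCard (m - 1)).filter (fun R => j ∈ R ∧ i ∉ R),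
        forestWeightTo a R i j =
      ∑ R ∈ ((univ : Finset V).powersetCard m).filter (fun R => j ∈ R ∧ i ∈ R),
        ∑ k ∈ univ.erase i, a i k * forestWeightTo a R k j := by
  refine sum_nbij' (fun R => insert i R) (fun R => R.erase i) ?_ ?_ ?_ ?_ ?_
  · intro R hR
    rw [mem_filter, mem_powersetCard_univ] at hR ⊢
    refine ⟨?_, mem_insert_of_mem hR.2.1, mem_insert_self i R⟩
    rw [card_insert_of_notMem hR.2.2, hR.1]
    omega
  · intro R hR
    rw [mem_filter, mem_powersetCard_univ] at hR ⊢
    refine ⟨?_, mem_erase.2 ⟨hij.symm, hR.2.1⟩, notMem_erase i R⟩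
    rw [card_erase_of_mem hR.2.2, hR.1]
  · intro R hR
    rw [mem_filter] at hR
    exact erase_insert hR.2.2
  · intro R hR
    rw [mem_filter] at hR
    exact insert_erase hR.2.2
  · intro R hR
    rw [mem_filter] at hR
    exact forestWeightTo_eq_sum_mul_forestWeightTo_insert a hR.2.2 hR.2.1

/-! ### §2 Proposition 4: `Q_{k+1} = σ_{k+1} I − L Q_k` -/

/-- **Proposition 4 (the Leverrier–Faddeev recurrence for the forest matrices): `Q_{k+1} = σ_{k+1} I −
L Q_k`** — in terms of the number of roots `m = n − k ≥ 1`: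
`Q^{[m−1]} + L · Q^{[m]} = σ^{[m−1]} · I` with `Q^{[m]}_{ij} = Σ_{R ∋ j, |R| = m} w_{ij}(R)` and
`σ^{[m]} = Σ_{|R| = m} w(R)`, for arbitrary arc weights in a commutative ring.
[cite: ChebotarevAgaev2002, §5 Proposition 4 (eq. (Fadd1): «`Q_{k+1} = σ_{k+1} I − LQ_k`, `k = 0, 1, …`»)] -/
theorem ChebotarevAgaev2002_prop_4 {m : ℕ} (hm : 1 ≤ m) :
    Matrix.of (fun i j : V =>
        ∑ R ∈ ((univ : Finset V).powersetCard (m - 1)).filter (fun R => j ∈ R), forestWeightTo a R i j) +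
      wLaplacian a * Matrix.of (fun k j : V =>
        ∑ R ∈ ((univ : Finset V).powersetCard m).filter (fun R => j ∈ R), forestWeightTo a R k j) =
      (∑ R ∈ (univ : Finset V).powersetCard (m - 1), forestWeight a R) • (1 : Matrix V V S) := by
  ext i j
  rw [Matrix.add_apply, Matrix.mul_apply, Matrix.smul_apply, smul_eq_mul, of_apply]
  simp only [of_apply]
  -- `Σ_k L_ik Q_kj = Σ_{R ∋ j} Σ_k L_ik w_kj(R)`, split by `i ∈ R`
  rw [show (∑ k, wLaplacian a i k *
        ∑ R ∈ ((univ : Finset V).powersetCard m).filter (fun R => j ∈ R), forestWeightTo a R k j) =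
      ∑ R ∈ ((univ : Finset V).powersetCard m).filter (fun R => j ∈ R),
        ∑ k, wLaplacian a i k * forestWeightTo a R k j by
    simp_rw [mul_sum]; exact sum_comm]
  rw [← sum_filter_add_sum_filter_not (((univ : Finset V).powersetCard (m - 1)).filter (fun R => j ∈ R))
      (fun R => i ∈ R),
    ← sum_filter_add_sum_filter_not (((univ : Finset V).powersetCard m).filter (fun R => j ∈ R))
      (fun R => i ∈ R) (fun R => ∑ k, wLaplacian a i k * forestWeightTo a R k j),
    filter_filter, filter_filter, filter_filter, filter_filter]
  rw [sum_congr rfl fun R hR =>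
      sum_wLaplacian_mul_forestWeightTo_of_mem a (R := R) ((mem_filter.1 hR).2.2) j,
    sum_congr rfl fun R hR =>
      sum_wLaplacian_mul_forestWeightTo_of_not_mem a (R := R) ((mem_filter.1 hR).2.2) ((mem_filter.1 hR).2.1),
    sum_const_zero, add_zero,
    sum_congr rfl fun R hR => forestWeightTo_of_mem_roots a R ((mem_filter.1 hR).2.2) j]
  by_cases hij : i = j
  · subst hij
    have hkey : ∑ R ∈ ((univ : Finset V).powersetCard m).filter (fun R => i ∈ R),
        ((∑ k ∈ univ.erase i, a i k) * forestWeight a R -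
          ∑ k ∈ univ.erase i, a i k * forestWeightTo a R k i) =
        ∑ R ∈ ((univ : Finset V).powersetCard (m - 1)).filter (fun R => i ∉ R), forestWeight a R := by
      rw [sum_congr rfl fun R hR => outWeight_mul_forestWeight_sub a (R := R) (mem_filter.1 hR).2]
      refine sum_nbij' (fun R => R.erase i) (fun R => insert i R) ?_ ?_ ?_ ?_ fun _ _ => rfl
      · intro R hR
        rw [mem_filter, mem_powersetCard_univ] at hR ⊢
        exact ⟨by rw [card_erase_of_mem hR.2, hR.1], notMem_erase i R⟩
      · intro R hR
        rw [mem_filter, mem_powersetCard_univ] at hR ⊢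
        refine ⟨?_, mem_insert_self i R⟩
        rw [card_insert_of_notMem hR.2, hR.1]
        omega
      · intro R hR
        exact insert_erase (mem_filter.1 hR).2
      · intro R hR
        exact erase_insert (mem_filter.1 hR).2
    simp only [if_true, Matrix.one_apply_eq, mul_one]
    rw [show (((univ : Finset V).powersetCard (m - 1)).filter fun R => i ∈ R ∧ i ∉ R) = ∅ from
        filter_eq_empty_iff.2 fun R _ h => h.2 h.1, sum_empty, add_zero,
      show (((univ : Finset V).powersetCard (m - 1)).filter fun R => i ∈ R ∧ i ∈ R) =
        ((univ : Finset V).powersetCard (m - 1)).filter fun R => i ∈ R from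
          filter_congr fun R _ => and_self_iff,
      show (((univ : Finset V).powersetCard m).filter fun R => i ∈ R ∧ i ∈ R) =
        ((univ : Finset V).powersetCard m).filter fun R => i ∈ R from
          filter_congr fun R _ => and_self_iff,
      hkey]
    exact sum_filter_add_sum_filter_not _ _ _
  · rw [Matrix.one_apply_ne hij, mul_zero]
    simp only [if_neg (Ne.symm hij), zero_sub, sum_const_zero, zero_add, sum_neg_distrib]
    rw [sum_forestWeightTo_not_mem_eq_card a hij hm]
    exact add_neg_cancel _

/-! ### §3 Traces: «`tr Q_k = (n − k) σ_k`» and `tr(L Q_k) = (k + 1) σ_{k+1}` -/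

/-- **«`tr Q_k = (n − k) σ_k`, which holds since every in-forest with `k` arcs has `n − k` roots»**:
`Σ_i Σ_{R ∋ i, |R| = m} w_{ii}(R) = m · Σ_{|R| = m} w(R)`. [cite: ChebotarevAgaev2002, §5 Proposition 4
(proof)] -/
theorem trace_forestMatrix (m : ℕ) :
    Matrix.trace (Matrix.of fun i j : V =>
        ∑ R ∈ ((univ : Finset V).powersetCard m).filter (fun R => j ∈ R), forestWeightTo a R i j) =
      (m : S) * ∑ R ∈ (univ : Finset V).powersetCard m, forestWeight a R := by
  rw [Matrix.trace]
  simp only [diag_apply, of_apply, forestWeightTo_self]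
  simp_rw [sum_filter]
  rw [sum_comm, mul_sum]
  refine sum_congr rfl fun R hR => ?_
  rw [← sum_filter, filter_mem_eq_inter, univ_inter, sum_const, nsmul_eq_mul,
    (mem_powersetCard_univ.1 hR)]

/-- **`σ_{k+1} = tr(L Q_k)/(k+1)`** with the denominator cleared: `tr(L · Q^{[m]}) = (n + 1 − m) σ^{[m−1]}`
(`k = n − m`), from the traces of Proposition 4. [cite: ChebotarevAgaev2002, §5 Proposition 4
(eq. (Fadd2))] -/
theorem trace_wLaplacian_mul_forestMatrix {m : ℕ} (hm : 1 ≤ m) (hmn : m ≤ Fintype.card V) :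
    Matrix.trace (wLaplacian a * Matrix.of (fun k j : V =>
        ∑ R ∈ ((univ : Finset V).powersetCard m).filter (fun R => j ∈ R), forestWeightTo a R k j)) =
      ((Fintype.card V + 1 - m : ℕ) : S) * ∑ R ∈ (univ : Finset V).powersetCard (m - 1), forestWeight a R := by
  have h := congrArg Matrix.trace (ChebotarevAgaev2002_prop_4 a hm)
  rw [Matrix.trace_add, trace_forestMatrix, Matrix.trace_smul, Matrix.trace_one, smul_eq_mul] at h
  rw [eq_sub_of_add_eq' h, Nat.cast_sub (show m ≤ Fintype.card V + 1 by omega), Nat.cast_sub hm]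
  push_cast
  ring

/-! ### §4 The columns of the matrix of maximum in-forests are null vectors of `L` -/

/-- **`L · Q_{n−d} = 0`**: if no spanning in-forest with `m − 1` roots carries weight (all `w_{ij}(R) = 0`
and `w(R) = 0` for `|R| = m − 1` — for non-negative weights this is `m = d`, the in-forest dimension),
then every column of `Q^{[m]}` is a null vector of `L`. [cite: ChebotarevAgaev2002, §5 («every nonzero
column of `J̄` (or `Q_{n−d}`) is an eigenvector of `L` that corresponds to the zero eigenvalue»)] -/
theorem wLaplacian_mul_forestMatrix_eq_zero {m : ℕ} (hm : 1 ≤ m)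
    (hQ : ∀ (R : Finset V) (i j : V), R.card = m - 1 → forestWeightTo a R i j = 0) :
    wLaplacian a * Matrix.of (fun k j : V =>
        ∑ R ∈ ((univ : Finset V).powersetCard m).filter (fun R => j ∈ R), forestWeightTo a R k j) = 0 := by
  rcases isEmpty_or_nonempty V with hV | hV
  · ext i j
    exact isEmptyElim i
  have h := ChebotarevAgaev2002_prop_4 a hm
  have hQ0 : Matrix.of (fun i j : V =>
      ∑ R ∈ ((univ : Finset V).powersetCard (m - 1)).filter (fun R => j ∈ R), forestWeightTo a R i j) = 0 := by
    ext i j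
    rw [of_apply, Matrix.zero_apply]
    exact sum_eq_zero fun R hR => hQ R i j (mem_powersetCard_univ.1 (mem_filter.1 hR).1)
  have hσ0 : ∑ R ∈ (univ : Finset V).powersetCard (m - 1), forestWeight a R = 0 :=
    sum_eq_zero fun R hR => by
      rw [← forestWeightTo_self a R (Classical.arbitrary V)]
      exact hQ R _ _ (mem_powersetCard_univ.1 hR)
  rw [hQ0, zero_add, hσ0, zero_smul] at h
  exact h

/-! ### §5 The row form `Q_{k+1} = σ_{k+1} I − Q_k L` by coefficient extraction over `S[X]` -/

section RowForm

open Polynomial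

/-- Forest weights commute with ring homomorphisms. [cite: ChebotarevAgaev2002, §2 (ε is a polynomial
in the arc weights)] -/
theorem map_forestWeight {T : Type*} [CommRing T] (f : S →+* T) (R : Finset V) :
    f (forestWeight a R) = forestWeight (fun u v => f (a u v)) R := by
  rw [forestWeight_def, forestWeight_def, map_sum]
  exact sum_congr rfl fun τ _ => map_prod f _ _

/-- `w_{ij}(R)` commutes with ring homomorphisms. [cite: ChebotarevAgaev2002, §2] -/
theorem map_forestWeightTo {T : Type*} [CommRing T] (f : S →+* T) (R : Finset V) (i j : V) :
    f (forestWeightTo a R i j) = forestWeightTo (fun u v => f (a u v)) R i j := by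
  rw [forestWeightTo_def, forestWeightTo_def, map_sum]
  exact sum_congr rfl fun τ _ => map_prod f _ _

/-- The Laplacian commutes with ring homomorphisms. [cite: ChebotarevAgaev2002, §3 (L = D − W)] -/
theorem wLaplacian_map {T : Type*} [CommRing T] (f : S →+* T) :
    wLaplacian (fun u v => f (a u v)) = (wLaplacian a).map f := by
  ext u v
  by_cases h : u = v
  · subst h
    rw [Matrix.map_apply, wLaplacian_apply_self, wLaplacian_apply_self, map_sum]
  · rw [Matrix.map_apply, wLaplacian_apply_of_ne _ h, wLaplacian_apply_of_ne _ h, map_neg]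

/-- A polynomial with constant term `1` is left-regular. [folklore] -/
private theorem isLeftRegular_of_coeff_zero_eq_one {p : S[X]} (hp : p.coeff 0 = 1) : IsLeftRegular p := by
  intro q r hqr
  have h0 : p * (q - r) = 0 := by
    have : p * q = p * r := hqr
    rw [mul_sub, this, sub_self]
  by_contra hne
  have hd : q - r ≠ 0 := sub_ne_zero.2 hne
  set d := q - r with hd'
  have hk : (p * d).coeff d.natTrailingDegree = d.trailingCoeff := by
    rw [coeff_mul, Finset.sum_eq_single (0, d.natTrailingDegree)]
    · rw [hp, one_mul]
      rfl
    · rintro ⟨i, j⟩ hij hne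
      have hij' : i + j = d.natTrailingDegree := Finset.mem_antidiagonal.1 hij
      have hj : j < d.natTrailingDegree := by
        by_contra hj
        have hi : i = 0 := by omega
        have hj' : j = d.natTrailingDegree := by omega
        exact hne (Prod.ext hi hj')
      rw [coeff_eq_zero_of_lt_natTrailingDegree hj, mul_zero]
    · intro h
      exact absurd (Finset.mem_antidiagonal.2 (zero_add _)) h
  rw [h0, coeff_zero] at hk
  exact hd (trailingCoeff_eq_zero.1 hk.symm)

omit [DecidableEq V] in
/-- Coefficient extraction: `coeff_{X^{n−m}} Σ_{R ∈ F} X^{n−|R|} C(f R) = Σ_{R ∈ F, |R| = m} f R`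
(private helper). [folklore] -/
private theorem coeff_sum_X_pow_mul_C (F : Finset (Finset V)) (f : Finset V → S) {m : ℕ}
    (hm : m ≤ Fintype.card V) :
    (∑ R ∈ F, (X : S[X]) ^ (Fintype.card V - R.card) * C (f R)).coeff (Fintype.card V - m) =
      ∑ R ∈ F.filter (fun R => R.card = m), f R := by
  rw [finsetSum_coeff, sum_filter]
  refine sum_congr rfl fun R _ => ?_
  rw [mul_comm, coeff_C_mul_X_pow]
  have hR : R.card ≤ Fintype.card V := by rw [← card_univ]; exact card_le_card (subset_univ R)
  by_cases h : R.card = m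
  · rw [if_pos (by rw [h]), if_pos h]
  · rw [if_neg (fun h' => h ((tsub_right_inj hm hR).1 h').symm), if_neg h]

/-- **Proposition 4, row form: `Q_{k+1} = σ_{k+1} I − Q_k L`** — for `1 ≤ m ≤ n`:
`Q^{[m−1]} + Q^{[m]} · L = σ^{[m−1]} · I`. Obtained from the tree's `Q·(I + L) = σ·I` over the
polynomial ring `S[X]` with the weights `X · a` (there `σ(X) = Σ_R X^{n−|R|} w(R)` has constant term
`w(V) = 1`, hence is regular), by extracting the coefficient of `X^{n−m+1}` — i.e. from `Q = adj(I+L)` and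
`adj(A)·A = A·adj(A)`. [cite: ChebotarevAgaev2002, §5 Proposition 4 with §4 Theorem 3′
(«`Q(τ) = adj(I + τL)`»)] -/
theorem ChebotarevAgaev2002_prop_4_row {m : ℕ} (hm : 1 ≤ m) (hmn : m ≤ Fintype.card V) :
    Matrix.of (fun i j : V =>
        ∑ R ∈ ((univ : Finset V).powersetCard (m - 1)).filter (fun R => j ∈ R), forestWeightTo a R i j) +
      Matrix.of (fun i k : V =>
        ∑ R ∈ ((univ : Finset V).powersetCard m).filter (fun R => k ∈ R), forestWeightTo a R i k) *
        wLaplacian a =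
      (∑ R ∈ (univ : Finset V).powersetCard (m - 1), forestWeight a R) • (1 : Matrix V V S) := by
  -- the weights `X · a` over `S[X]`
  set b : V → V → S[X] := fun u v => X * C (a u v) with hb
  have hLb : wLaplacian b = (X : S[X]) • (wLaplacian a).map C := by
    rw [hb, wLaplacian_smul, wLaplacian_map]
  have hwb : ∀ R : Finset V, forestWeight b R = X ^ (Fintype.card V - R.card) * C (forestWeight a R) := by
    intro R
    rw [hb, forestWeight_smul, map_forestWeight]
  have hwtb : ∀ (R : Finset V) (i j : V),
      forestWeightTo b R i j = X ^ (Fintype.card V - R.card) * C (forestWeightTo a R i j) := by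
    intro R i j
    rw [hb, forestWeightTo_smul, map_forestWeightTo]
  -- `σ(X)` has constant term `1`, so it is regular
  have hσ : IsLeftRegular (∑ R : Finset V, forestWeight b R) := by
    apply isLeftRegular_of_coeff_zero_eq_one
    simp_rw [hwb]
    rw [← Nat.sub_self (Fintype.card V), coeff_sum_X_pow_mul_C _ _ le_rfl, ← card_univ,
      show (univ : Finset (Finset V)).filter (fun R => R.card = (univ : Finset V).card) = {univ} from ?_,
      sum_singleton, forestWeight_univ]
    ext R
    simp only [mem_filter, mem_univ, true_and, mem_singleton]
    exact ⟨fun h => eq_univ_of_card R h, fun h => by rw [h]⟩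
  have H := accessibility_mul_one_add_wLaplacian b hσ
  -- coefficient extraction facts
  have hF : ∀ (x : V) (e : ℕ),
      ((univ : Finset (Finset V)).filter (fun R => x ∈ R)).filter (fun R => R.card = e) =
        ((univ : Finset V).powersetCard e).filter (fun R => x ∈ R) := by
    intro x e
    ext R
    simp [and_comm]
  have hs : ∀ {e : ℕ}, e ≤ Fintype.card V →
      (∑ R : Finset V, (X : S[X]) ^ (Fintype.card V - R.card) * C (forestWeight a R)).coeff
          (Fintype.card V - e) =
        ∑ R ∈ (univ : Finset V).powersetCard e, forestWeight a R := by
    intro e he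
    rw [coeff_sum_X_pow_mul_C _ _ he]
    exact sum_congr (by ext R; simp) fun _ _ => rfl
  ext i j
  have hq : ∀ (x : V) {e : ℕ}, e ≤ Fintype.card V →
      (∑ R ∈ (univ : Finset (Finset V)).filter (fun R => x ∈ R),
          (X : S[X]) ^ (Fintype.card V - R.card) * C (forestWeightTo a R i x)).coeff (Fintype.card V - e) =
        ∑ R ∈ ((univ : Finset V).powersetCard e).filter (fun R => x ∈ R), forestWeightTo a R i x := by
    intro x e he
    rw [coeff_sum_X_pow_mul_C _ _ he, hF]
  have hq' : ∀ x : V,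
      (∑ R ∈ (univ : Finset (Finset V)).filter (fun R => x ∈ R),
          (X : S[X]) ^ (Fintype.card V - R.card) * C (forestWeightTo a R i x)).coeff (Fintype.card V - m) =
        ∑ R ∈ ((univ : Finset V).powersetCard m).filter (fun R => x ∈ R), forestWeightTo a R i x :=
    fun x => hq x hmn
  -- the `(i,j)` entry of `Q(X)·(I + X·L) = σ(X)·I`
  have Hij := congrFun (congrFun H i) j
  rw [Matrix.mul_apply, Matrix.smul_apply, smul_eq_mul] at Hij
  simp only [of_apply, Matrix.add_apply, hLb, Matrix.smul_apply, Matrix.map_apply, smul_eq_mul,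
    Matrix.one_apply, mul_add, sum_add_distrib, mul_ite, mul_one, mul_zero, sum_ite_eq', mem_univ,
    if_true] at Hij
  simp_rw [hwtb, hwb] at Hij
  rw [show (∑ x, (∑ R ∈ (univ : Finset (Finset V)).filter (fun R => x ∈ R),
        (X : S[X]) ^ (Fintype.card V - R.card) * C (forestWeightTo a R i x)) *
          (X * C (wLaplacian a x j))) =
      X * ∑ x, (∑ R ∈ (univ : Finset (Finset V)).filter (fun R => x ∈ R),
        (X : S[X]) ^ (Fintype.card V - R.card) * C (forestWeightTo a R i x)) * C (wLaplacian a x j) by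
      rw [mul_sum]; exact sum_congr rfl fun x _ => by ring] at Hij
  -- extract the coefficient of `X^{n−m+1}`
  have hdeg : Fintype.card V - (m - 1) = Fintype.card V - m + 1 := by omega
  have Hc : (_ : S[X]).coeff (Fintype.card V - m + 1) = (_ : S[X]).coeff (Fintype.card V - m + 1) :=
    congrArg (fun p : S[X] => p.coeff (Fintype.card V - m + 1)) Hij
  rw [coeff_add, coeff_X_mul, ← hdeg, hq j (by omega), finsetSum_coeff] at Hc
  simp_rw [coeff_mul_C, hq'] at Hc
  have hR : (if i = j then ∑ R : Finset V, (X : S[X]) ^ (Fintype.card V - R.card) * C (forestWeight a R)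
      else 0).coeff (Fintype.card V - (m - 1)) =
      if i = j then ∑ R ∈ (univ : Finset V).powersetCard (m - 1), forestWeight a R else 0 := by
    split_ifs
    · exact hs (by omega)
    · exact coeff_zero _
  rw [hR] at Hc
  -- assemble
  rw [Matrix.add_apply, Matrix.mul_apply, Matrix.smul_apply, smul_eq_mul, Matrix.one_apply, mul_ite,
    mul_one, mul_zero]
  exact Hc

/-- **`Q_{n−d} · L = 0`**: if all `w_{ij}(R)` vanish for `|R| = m − 1` then the ROWS of the matrix of the
in-forests with `m` roots are left null vectors of `L` — for `L = I − P` they are invariant measures of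
the chain (the algebraic core of the Markov chain tree theorem for general chains).
[cite: ChebotarevAgaev2002, §5 («`J̄`, the eigenprojection of `L`»; Proposition (LJ̄ = 0))] -/
theorem forestMatrix_mul_wLaplacian_eq_zero {m : ℕ} (hm : 1 ≤ m) (hmn : m ≤ Fintype.card V)
    (hQ : ∀ (R : Finset V) (i j : V), R.card = m - 1 → forestWeightTo a R i j = 0) :
    Matrix.of (fun i k : V =>
        ∑ R ∈ ((univ : Finset V).powersetCard m).filter (fun R => k ∈ R), forestWeightTo a R i k) *
        wLaplacian a = 0 := by
  rcases isEmpty_or_nonempty V with hV | hV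
  · ext i j
    exact isEmptyElim i
  have h := ChebotarevAgaev2002_prop_4_row a hm hmn
  have hQ0 : Matrix.of (fun i j : V =>
      ∑ R ∈ ((univ : Finset V).powersetCard (m - 1)).filter (fun R => j ∈ R), forestWeightTo a R i j) = 0 := by
    ext i j
    rw [of_apply, Matrix.zero_apply]
    exact sum_eq_zero fun R hR => hQ R i j (mem_powersetCard_univ.1 (mem_filter.1 hR).1)
  have hσ0 : ∑ R ∈ (univ : Finset V).powersetCard (m - 1), forestWeight a R = 0 :=
    sum_eq_zero fun R hR => by
      rw [← forestWeightTo_self a R (Classical.arbitrary V)]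
      exact hQ R _ _ (mem_powersetCard_univ.1 hR)
  rw [hQ0, zero_add, hσ0, zero_smul] at h
  exact h

end RowForm

end Literature.Combinatorics.Enumerative
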